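import Literature.Analysis.FluidPDE.LuoTitiPerturbationFracNSR
import Literature.Analysis.FluidPDE.DeRosaGluedEnergy
import Literature.Analysis.FluidPDE.DeRosaPerturbationNSR
import Literature.Analysis.FluidPDE.LerayHopfFrac
import Summits.NavierStokesRegularity.FunctionalMining.RateBudgets
import HarnessLib

/-!
# FunctionalMining — the homogeneous Sobolev energies `‖u‖²_{Ḣˢ}` (K0 family `EF.s`): exact balance

Search for candidate a priori estimates; no regularity claim. Cell `pub-nsfunc`, prove seat
(gen 11). The K0 family `EF.s` (`∫ ||∇|^s u|²`, rows `EF.s=3/4, 5/4, 3/2, 2 | T_LD | G1` and the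
Lyapunov mirrors `EK.EF.s`) is the homogeneous Sobolev energy. With the tree's spectral fractional
Laplacian `(-Δ)^s` on smooth vector fields of `T^d` (`Torus.fracLaplacian`, files
`FractionalNSTorus`, `FracLaplacianSmooth`, `FracLaplacianSpaceTime`) we set

`E_s(v) := ∫ ⟪v, (-Δ)^s v⟫ = ∑_k (4π²|k|²)^s ‖v̂(k)‖²`  (`torusHsEnergy`, `torusHsEnergy_eq_tsum`),

so `E_1 = ‖∇v‖₂² = 2ℰ` and `E_2 = ‖Δv‖₂² = 𝒫`. DYNAMIC HALF of the rows, for EVERY real `s ≥ 0`: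
along every classical unforced solution of Navier–Stokes on `T^d × [a, b]`,

`d/dt E_s(u) = 2∫⟪(-Δ)^s u, ∂ₜu⟫ = −2ν E_{s+1}(u) − 2∫⟪(-Δ)^s u, (u·∇)u⟫`

(`hasDerivWithinAt_torusHsEnergy_NS`): `∂ₜ` commutes with `(-Δ)^s` through its representation as a
mollification of the elliptic iterate (`timeDerivWithin_fracLaplacian_comm`; tree
`Torus.fracLaplacian_eq_convolution`, `Torus.timeDerivWithin_convolution_Icc`), `(-Δ)^s` is symmetric
(`Torus.integral_inner_fracLaplacian_comm`), `∫⟪(-Δ)^s u, Δu⟫ = −E_{s+1}` (`(-Δ)^1 = −Δ`, semigroup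
law `Torus.fracLaplacian_fracLaplacian`), and the pressure drops: `∫⟪(-Δ)^s u, ∇p⟫ = ∫⟪u, ∇P⟫ = 0`
(`Torus.fracLaplacian_gradient_eq_gradient`, `div u = 0`). Packaged as
`HasInitialRate (torusHsEnergy s) N_s V_s` with `V_s = −2E_{s+1} ≤ 0` (the heat sieve is passed) and
`N_s(v) = −2∫⟪(-Δ)^s v, (v·∇)v⟫`. The STATIC half (the bound of `N_s` through `2ℰ`, `E_s`, `E_{s+1}`:
lattice product laws / Kato–Ponce, SIEVELD §3.6) is not in this file. Identities along smooth
solutions only.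
-/

noncomputable section

open MeasureTheory Set Filter Topology Function UnitAddTorus
open scoped InnerProductSpace RealInnerProductSpace ContDiff Convolution

namespace Summit.NavierStokesRegularity.FunctionalMining

open Literature.Analysis Literature.Analysis.FunctionSpaces Literature.Analysis.FluidPDE
open Literature.Analysis.FunctionSpaces.Torus Literature.Analysis.FluidPDE.Torus

variable {d : Type*} [Fintype d] [DecidableEq d]

/-! ## 1. The functional and its rates -/

/-- **K0 family `EF.s`: the homogeneous Sobolev energy `E_s(v) = ∫⟪v, (-Δ)^s v⟫ = ‖v‖²_{Ḣˢ}`**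
(`= ∑_k (4π²|k|²)^s ‖v̂(k)‖²` for smooth `v`, `torusHsEnergy_eq_tsum`). Search for candidate a priori
estimates; no regularity claim. [ours; packaging] -/
def torusHsEnergy (s : ℝ) (v : UnitAddTorus d → EuclideanSpace ℝ d) : ℝ :=
  ∫ x, ⟪v x, fracLaplacian s v x⟫_ℝ

/-- **Viscous (heat-flow) rate of `E_s`**: `V_s(v) = −2 E_{s+1}(v)`. [ours; bookkeeping] -/
def hsViscousRate (s : ℝ) (v : UnitAddTorus d → EuclideanSpace ℝ d) : ℝ :=
  -2 * torusHsEnergy (s + 1) v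

/-- **Inertial rate of `E_s`**: `N_s(v) = −2∫⟪(-Δ)^s v, (v·∇)v⟫`. [ours; bookkeeping] -/
def hsInertialRate (s : ℝ) (v : UnitAddTorus d → EuclideanSpace ℝ d) : ℝ :=
  -2 * ∫ x, ⟪fracLaplacian s v x, Torus.convect v v x⟫_ℝ

/-- **Parseval form**: `E_s(v) = ∑_k (4π²|k|²)^s ‖v̂(k)‖²` for smooth `v` and `s ≥ 0`. [folklore] -/
theorem torusHsEnergy_eq_tsum {s : ℝ} (hs : 0 ≤ s) {v : UnitAddTorus d → EuclideanSpace ℝ d}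
    (hv : IsSmooth v) :
    torusHsEnergy s v = ∑' k : d → ℤ, fracSymbol s k *
      ‖mFourierCoeff (EuclideanSpace.complexify ∘ v) k‖ ^ 2 := by
  unfold torusHsEnergy
  rw [integral_inner_fracLaplacian_eq_tsum hs hv hv.continuous]
  refine tsum_congr fun k => ?_
  congr 1
  have h := inner_self_eq_norm_sq (𝕜 := ℂ) (mFourierCoeff (EuclideanSpace.complexify ∘ v) k)
  rw [RCLike.re_to_complex] at h
  exact h

/-- `E_s(v) ≥ 0` for smooth `v`, `s ≥ 0`. [folklore] -/
theorem torusHsEnergy_nonneg {s : ℝ} (hs : 0 ≤ s) {v : UnitAddTorus d → EuclideanSpace ℝ d}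
    (hv : IsSmooth v) : 0 ≤ torusHsEnergy s v := by
  rw [torusHsEnergy_eq_tsum hs hv]
  exact tsum_nonneg fun k => mul_nonneg (fracSymbol_nonneg s k) (sq_nonneg _)

/-- The viscous rate is non-positive on smooth fields: `V_s(v) = −2E_{s+1}(v) ≤ 0` (the heat sieve
`HeatSieve` is passed by the family `EF.s`). [ours] -/
theorem hsViscousRate_nonpos {s : ℝ} (hs : 0 ≤ s) {v : UnitAddTorus d → EuclideanSpace ℝ d}
    (hv : IsSmooth v) : hsViscousRate s v ≤ 0 := by
  unfold hsViscousRate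
  have := torusHsEnergy_nonneg (by linarith : 0 ≤ s + 1) hv
  linarith

/-- **`E_1(v) = ‖∇v‖₂²`** (`= ∫ ∑ᵢ ‖∂ᵢv‖² = Torus.gradNormSq v`) for smooth `v`. [folklore] -/
theorem torusHsEnergy_one {v : UnitAddTorus d → EuclideanSpace ℝ d} (hv : IsSmooth v) :
    torusHsEnergy 1 v = Torus.gradNormSq v := by
  unfold torusHsEnergy Torus.gradNormSq
  rw [fracLaplacian_one hv]
  simp only [Pi.neg_apply, inner_neg_right]
  rw [integral_neg, integral_inner_laplacian_eq_neg_holds hv, neg_neg]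
  exact (integral_finsetSum Finset.univ (f := fun i x => ‖Torus.partialDeriv i v x‖ ^ 2)
    (fun i _ => ((hv.partialDeriv i).continuous.norm.pow 2).integrable_unitAddTorus)).symm

/-! ## 2. `∂ₜ` commutes with `(-Δ)^s` along jointly smooth fields on `[a, b] × T^d` -/

/-- `∂ₜ (1 − (4π²)⁻¹Δ)^m = (1 − (4π²)⁻¹Δ)^m ∂ₜ` for jointly smooth fields on `[a,b] × T^d`. [folklore] -/
theorem timeDerivWithin_oneSubLapIter_comm {a b : ℝ} (hab : a < b) :
    ∀ (m : ℕ) {u : ℝ → UnitAddTorus d → EuclideanSpace ℝ d}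
      (_ : Torus.IsSmoothSpaceTimeOn (Icc a b) u) {t : ℝ} (_ : t ∈ Icc a b) (x : UnitAddTorus d),
      Torus.timeDerivWithin (Icc a b) ((fun c : ℝ → UnitAddTorus d → EuclideanSpace ℝ d =>
          fun s y => c s y - (4 * Real.pi ^ 2)⁻¹ • Torus.laplacian (c s) y)^[m] u) t x =
        oneSubLapIter m (Torus.timeDerivWithin (Icc a b) u t) x
  | 0, _, _, _, _, _ => rfl
  | m + 1, u, hu, t, ht, x => by
    have hS : UniqueDiffOn ℝ (Icc a b) := uniqueDiffOn_Icc hab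
    set Pu : ℝ → UnitAddTorus d → EuclideanSpace ℝ d :=
      fun s y => u s y - (4 * Real.pi ^ 2)⁻¹ • Torus.laplacian (u s) y with hPu
    have hPu_s : Torus.IsSmoothSpaceTimeOn (Icc a b) Pu := hu.sub ((hu.laplacian hS).const_smul _)
    have hPu_t : Torus.timeDerivWithin (Icc a b) Pu t = fun y =>
        Torus.timeDerivWithin (Icc a b) u t y -
          (4 * Real.pi ^ 2)⁻¹ • Torus.laplacian (Torus.timeDerivWithin (Icc a b) u t) y := by
      funext y
      have h1 := hu.hasDerivWithinAt_slice ht y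
      have h2 := (hu.laplacian hS).hasDerivWithinAt_slice ht y
      have h3 : HasDerivWithinAt (fun τ => Pu τ y)
          (Torus.timeDerivWithin (Icc a b) u t y -
            (4 * Real.pi ^ 2)⁻¹ • Torus.timeDerivWithin (Icc a b) (fun s => Torus.laplacian (u s)) t y)
          (Icc a b) t := h1.fun_sub (h2.fun_const_smul _)
      rw [Torus.timeDerivWithin, h3.derivWithin (hS t ht), Torus.timeDerivWithin_laplacian_comm hab hu ht y]
    rw [Function.iterate_succ_apply, timeDerivWithin_oneSubLapIter_comm hab m hPu_s ht x,
      oneSubLapIter_def, oneSubLapIter_def, Function.iterate_succ_apply, hPu_t]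

/-- **`∂ₜ (-Δ)^θ u = (-Δ)^θ ∂ₜu`** for jointly smooth `u` on `[a, b] × T^d` and `θ ≥ 0` (one-sided in
time at the endpoints): `(-Δ)^θ = K_θ ⋆ (1 − (4π²)⁻¹Δ)^M` slice-wise (`Torus.fracLaplacian_eq_convolution`),
`∂ₜ` passes through the mollification (`Torus.timeDerivWithin_convolution_Icc`) and through the
elliptic iterate. [folklore] -/
theorem timeDerivWithin_fracLaplacian_comm {θ : ℝ} (hθ : 0 ≤ θ) {a b : ℝ} (hab : a < b)
    {u : ℝ → UnitAddTorus d → EuclideanSpace ℝ d} (hu : Torus.IsSmoothSpaceTimeOn (Icc a b) u)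
    {t : ℝ} (ht : t ∈ Icc a b) (x : UnitAddTorus d) :
    Torus.timeDerivWithin (Icc a b) (fun s => fracLaplacian θ (u s)) t x =
      fracLaplacian θ (Torus.timeDerivWithin (Icc a b) u t) x := by
  have hS : UniqueDiffOn ℝ (Icc a b) := uniqueDiffOn_Icc hab
  set M := fracKerOrder θ d with hM
  set w : ℝ → UnitAddTorus d → EuclideanSpace ℝ d :=
    (fun c : ℝ → UnitAddTorus d → EuclideanSpace ℝ d =>
      fun s y => c s y - (4 * Real.pi ^ 2)⁻¹ • Torus.laplacian (c s) y)^[M] u with hw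
  have hws : Torus.IsSmoothSpaceTimeOn (Icc a b) w := isSmoothSpaceTimeOn_iterate_of_uniqueDiffOn hS hu M
  have e1 : ∀ s ∈ Icc a b, fracLaplacian θ (u s) = fracKernel θ ⋆ w s := by
    intro s hs
    rw [fracLaplacian_eq_convolution hθ (hu.isSmooth_slice hs), hw, iterate_spaceTime_slice]
    rfl
  have e2 : Torus.timeDerivWithin (Icc a b) (fun s => fracLaplacian θ (u s)) t x =
      Torus.timeDerivWithin (Icc a b) (fun s => fracKernel θ ⋆ w s) t x := by
    unfold Torus.timeDerivWithin
    exact derivWithin_congr (fun s hs => by show fracLaplacian θ (u s) x = _; rw [e1 s hs])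
      (by show fracLaplacian θ (u t) x = _; rw [e1 t ht])
  rw [e2, Torus.timeDerivWithin_convolution_Icc (integrable_fracKernel hθ) hab hws ht x]
  have e3 : Torus.timeDerivWithin (Icc a b) w t = oneSubLapIter M (Torus.timeDerivWithin (Icc a b) u t) :=
    funext fun y => timeDerivWithin_oneSubLapIter_comm hab M hu ht y
  rw [e3, ← fracLaplacian_eq_convolution hθ (hu.isSmooth_timeDerivWithin hS ht)]

/-! ## 3. The derivative of `E_s` along jointly smooth fields -/

/-- **`d/dt E_s(u) = 2∫⟪(-Δ)^s u, ∂ₜu⟫`** for `u` jointly smooth on `[a, b] × T^d`, `s ≥ 0` (product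
rule under the integral, `∂ₜ(-Δ)^s = (-Δ)^s∂ₜ`, symmetry of `(-Δ)^s`). [folklore] -/
theorem hasDerivWithinAt_torusHsEnergy {s : ℝ} (hs : 0 ≤ s) {a b : ℝ} (hab : a < b)
    {u : ℝ → UnitAddTorus d → EuclideanSpace ℝ d} (hu : Torus.IsSmoothSpaceTimeOn (Icc a b) u)
    {t : ℝ} (ht : t ∈ Icc a b) :
    HasDerivWithinAt (fun τ => torusHsEnergy s (u τ))
      (2 * ∫ x, ⟪fracLaplacian s (u t) x, Torus.timeDerivWithin (Icc a b) u t x⟫_ℝ) (Icc a b) t := by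
  have hS : UniqueDiffOn ℝ (Icc a b) := uniqueDiffOn_Icc hab
  have hint : (interior (Icc a b)).Nonempty := by
    rw [interior_Icc]; exact nonempty_Ioo.2 hab
  have hΛ : Torus.IsSmoothSpaceTimeOn (Icc a b) (fun τ => fracLaplacian s (u τ)) :=
    hu.fracLaplacian hs (convex_Icc a b) hint
  have hD := (hu.inner hΛ).hasDerivWithinAt_integral (convex_Icc a b) ht
  unfold torusHsEnergy
  refine hD.congr_deriv ?_
  have hut : IsSmooth (u t) := hu.isSmooth_slice ht
  have hAt : IsSmooth (Torus.timeDerivWithin (Icc a b) u t) := hu.isSmooth_timeDerivWithin hS ht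
  have e1 : ∀ x, Torus.timeDerivWithin (Icc a b) (fun τ y => ⟪u τ y, fracLaplacian s (u τ) y⟫_ℝ) t x =
      ⟪u t x, fracLaplacian s (Torus.timeDerivWithin (Icc a b) u t) x⟫_ℝ +
        ⟪fracLaplacian s (u t) x, Torus.timeDerivWithin (Icc a b) u t x⟫_ℝ := by
    intro x
    rw [Torus.IsSmoothSpaceTimeOn.timeDerivWithin_inner hu hΛ hS ht x,
      timeDerivWithin_fracLaplacian_comm hs hab hu ht x, real_inner_comm (fracLaplacian s (u t) x)]
  simp_rw [e1]
  have i1 : Integrable fun x => ⟪u t x, fracLaplacian s (Torus.timeDerivWithin (Icc a b) u t) x⟫_ℝ :=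
    (hut.continuous.inner (hAt.fracLaplacian hs).continuous).integrable_unitAddTorus
  have i2 : Integrable fun x => ⟪fracLaplacian s (u t) x, Torus.timeDerivWithin (Icc a b) u t x⟫_ℝ :=
    ((hut.fracLaplacian hs).continuous.inner hAt.continuous).integrable_unitAddTorus
  rw [integral_add i1 i2, ← integral_inner_fracLaplacian_comm hs hut hAt, two_mul]

/-! ## 4. The three terms of the momentum equation -/

section Momentum

/-! The pressure identity uses the tree's `Torus.fracLaplacian_gradient_eq_gradient`, stated for index
types in `Type`; from here on the index type `ι` lives in `Type` (the rows use `ι = Fin 3`). -/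

variable {ι : Type} [Fintype ι] [DecidableEq ι]


/-- **Viscous term**: `∫⟪(-Δ)^s v, Δv⟫ = −E_{s+1}(v)` for smooth `v`, `s ≥ 0` (`Δ = −(-Δ)^1`,
symmetry, semigroup law). [folklore] -/
theorem integral_inner_fracLaplacian_laplacian {s : ℝ} (hs : 0 ≤ s)
    {v : UnitAddTorus ι → EuclideanSpace ℝ ι} (hv : IsSmooth v) :
    ∫ x, ⟪fracLaplacian s v x, Torus.laplacian v x⟫_ℝ = -torusHsEnergy (s + 1) v := by
  have hΔ : Torus.laplacian v = -fracLaplacian 1 v := by rw [fracLaplacian_one hv, neg_neg]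
  unfold torusHsEnergy
  rw [hΔ]
  simp only [Pi.neg_apply, inner_neg_right]
  rw [integral_neg, integral_inner_fracLaplacian_comm hs hv (hv.fracLaplacian zero_le_one),
    fracLaplacian_fracLaplacian hs zero_le_one hv]

/-- **Pressure term**: `∫⟪(-Δ)^s v, ∇p⟫ = 0` for smooth divergence-free `v`, smooth `p`, `s ≥ 0`
(`(-Δ)^s` is symmetric, `(-Δ)^s ∇p = ∇P` with `P` smooth, and `∫⟪v, ∇P⟫ = 0`). [folklore] -/
theorem integral_inner_fracLaplacian_gradient_eq_zero [Nonempty ι] {s : ℝ} (hs : 0 ≤ s)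
    {v : UnitAddTorus ι → EuclideanSpace ℝ ι} (hv : IsSmooth v) (hdiv : IsDivFree v)
    {p : UnitAddTorus ι → ℝ} (hp : IsSmooth p) :
    ∫ x, ⟪fracLaplacian s v x, Torus.gradient p x⟫_ℝ = 0 := by
  obtain ⟨i₀⟩ := ‹Nonempty ι›
  rw [integral_inner_fracLaplacian_comm hs hv hp.gradient, fracLaplacian_gradient_eq_gradient hs hp i₀]
  set P : UnitAddTorus ι → ℝ :=
    fun y => fracLaplacian s (fun z => p z • EuclideanSpace.single i₀ (1 : ℝ)) y i₀ with hP
  have hPs : IsSmooth P := ((hp.smul' (isSmooth_const _)).fracLaplacian hs).apply i₀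
  have h := integral_inner_gradient_eq_zero_of_isDivFree hv hPs hdiv
  have h' : ∫ x, ⟪v x, Torus.gradient P x⟫_ℝ = ∫ x, ⟪Torus.gradient P x, v x⟫_ℝ :=
    integral_congr_ae (ae_of_all _ fun x => real_inner_comm (Torus.gradient P x) (v x))
  rw [h', h]

/-! ## 5. The exact balance along classical solutions -/

/-- **`d/dt E_s(u) = N_s(u) + ν V_s(u) = −2ν E_{s+1}(u) − 2∫⟪(-Δ)^s u, (u·∇)u⟫`** along every
classical unforced solution of Navier–Stokes on `T^d × [a, b]`, for every real `s ≥ 0`. [ours] -/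
theorem hasDerivWithinAt_torusHsEnergy_NS [Nonempty ι] {s : ℝ} (hs : 0 ≤ s) {a b ν : ℝ}
    {u : ℝ → UnitAddTorus ι → EuclideanSpace ℝ ι} {p : ℝ → UnitAddTorus ι → ℝ}
    (h : Torus.IsClassicalNSSolutionOn (Icc a b) ν 0 u p) (hab : a < b) {t : ℝ} (ht : t ∈ Icc a b) :
    HasDerivWithinAt (fun τ => torusHsEnergy s (u τ))
      (hsInertialRate s (u t) + ν * hsViscousRate s (u t)) (Icc a b) t := by
  have hS : UniqueDiffOn ℝ (Icc a b) := uniqueDiffOn_Icc hab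
  have hu : Torus.IsSmoothSpaceTimeOn (Icc a b) u := h.smooth_velocity
  have hut : IsSmooth (u t) := hu.isSmooth_slice ht
  have hpt : IsSmooth (p t) := h.smooth_pressure.isSmooth_slice ht
  have hΛ : IsSmooth (fracLaplacian s (u t)) := hut.fracLaplacian hs
  refine (hasDerivWithinAt_torusHsEnergy hs hab hu ht).congr_deriv ?_
  -- the momentum equation: `∂ₜu = νΔu − ∇p − (u·∇)u`
  have hA : ∀ x, Torus.timeDerivWithin (Icc a b) u t x =
      ν • Torus.laplacian (u t) x - Torus.gradient (p t) x - Torus.convect (u t) (u t) x := by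
    intro x
    have hm := h.momentum t ht x
    have h0 : (0 : ℝ → UnitAddTorus ι → EuclideanSpace ℝ ι) t x = 0 := rfl
    rw [h0, add_zero] at hm
    rw [eq_sub_iff_add_eq, hm]
  simp_rw [hA, inner_sub_right, inner_smul_right]
  have iΔ : Integrable fun x => ⟪fracLaplacian s (u t) x, Torus.laplacian (u t) x⟫_ℝ :=
    (hΛ.continuous.inner hut.laplacian.continuous).integrable_unitAddTorus
  have iP : Integrable fun x => ⟪fracLaplacian s (u t) x, Torus.gradient (p t) x⟫_ℝ :=
    (hΛ.continuous.inner hpt.gradient.continuous).integrable_unitAddTorus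
  have iC : Integrable fun x => ⟪fracLaplacian s (u t) x, Torus.convect (u t) (u t) x⟫_ℝ :=
    (hΛ.continuous.inner (hut.convect hut).continuous).integrable_unitAddTorus
  have i1 : Integrable fun x => ν * ⟪fracLaplacian s (u t) x, Torus.laplacian (u t) x⟫_ℝ := iΔ.const_mul ν
  have i2 : Integrable fun x => ν * ⟪fracLaplacian s (u t) x, Torus.laplacian (u t) x⟫_ℝ -
      ⟪fracLaplacian s (u t) x, Torus.gradient (p t) x⟫_ℝ := i1.sub iP
  rw [integral_sub i2 iC, integral_sub i1 iP, integral_const_mul,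
    integral_inner_fracLaplacian_laplacian hs hut,
    integral_inner_fracLaplacian_gradient_eq_zero hs hut (h.divFree t ht) hpt]
  unfold hsInertialRate hsViscousRate
  ring

/-- **The initial rates of the family `EF.s`, real `s ≥ 0`**: `HasInitialRate (torusHsEnergy s) N_s V_s`
on `T³`, `V_s = −2E_{s+1}`, `N_s(v) = −2∫⟪(-Δ)^s v, (v·∇)v⟫`. [ours] -/
theorem hasInitialRate_torusHsEnergy {s : ℝ} (hs : 0 ≤ s) :
    HasInitialRate (d := ι) (torusHsEnergy s) (hsInertialRate s) (hsViscousRate s) := by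
  intro hd ν _ a b hab u p hsol _
  haveI : Nonempty ι := Fintype.card_pos_iff.mp (by omega)
  exact hasDerivWithinAt_torusHsEnergy_NS hs hsol hab (left_mem_Icc.2 hab.le)

end Momentum

end Summit.NavierStokesRegularity.FunctionalMining
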